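import Summits.RiemannHypothesis.RiemannHypothesis.Theorems.HandoffDodgerCeilingTheorem
import Summits.RiemannHypothesis.RiemannHypothesis.Theorems.HandoffDodgerSmallHorizon
import Summits.RiemannHypothesis.RiemannHypothesis.Theorems.HandoffDodgerSmallProfile
import Summits.RiemannHypothesis.RiemannHypothesis.Theorems.HandoffDodgerSmallWindow
import Summits.RiemannHypothesis.RiemannHypothesis.Theorems.HandoffDodgerSmallCost
import Summits.RiemannHypothesis.RiemannHypothesis.Theorems.HandoffDodgerSmallPhi
import Summits.RiemannHypothesis.RiemannHypothesis.Theorems.SemilocalClassLawLeaves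
import HarnessLib

/-!
# HANDOFF — SMALL THRESHOLD (6): THE RH-FREE WALL CEILING AND THE UPPER CLAUSE FROM `q₀ = 60000` (rh-explicit, D-0040 WEIL column prover seat handoff-prove-2 gen11, ATTEMPT-21 §7)

RH-FREE. HONEST FRAMING: nothing here bears on the truth of RH; every statement is an UPPER bound on the wall offsets
`δ*(q) = a*(S_q) − (log q)/2` or an upper clause `a*(S_q) < (log q')/2` (RH is the LOWER clause `∀ q, 0 ≤ δ*(q)`, not touched).

gen10's `HandoffDodgerCeilingTheorem.subwindowZeroSumFamily_exp204` assembled the mollified zero-dodger of the track at the asymptotic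
schedule `y = (3/5)L^{3/2}`, `N₁ = 4⌈L⌉` and proved `SubwindowZeroSumFamily (7/100) ⌈e^{204}⌉`. The threshold-free theorem
`HandoffDodgerExplicit.dodger_witness_explicit` is re-assembled here at the schedule of ATTEMPT-21 — `y = 2L^{3/2}`, `N₁ = ⌈13L/2⌉`,
`n = q³`, `C = 1/5`, `b = L/2 − ε` — whose hypotheses hold for EVERY `L = log q ≥ 11.002` (parts (1)–(5):
`HandoffDodgerSmall{Horizon,Profile,Window,Cost,Phi}`):
* `subwindowZeroSumFamily_sixtyThousand : SubwindowZeroSumFamily (1/5) 60000`;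
* `dodgerWallCeiling_sixtyThousand : DodgerWallCeiling (1/5) 60000` — `δ*(q) ≤ (1/5)(log q)^{3/2} q^{−3/2}` for every prime `q ≥ 60000`;
* `upperClause_from_sixtyThousand` — the UPPER CLAUSE `a*(S_q) < (log q⁺)/2` for EVERY prime `q ≥ 60000` (directly from the
  witness family's window clause; no `|C| ≤ 7/100` needed);
* `semilocalClassLawTail_iff_range_sixtyThousand` — the WEIL route's crux `SemilocalClassLaw.SemilocalClassLawTail` (C-I(a) for the
  primes `q ≥ 80`) is EQUIVALENT to the upper clause at the finitely many primes `80 ≤ q < 60000` (a range inside the cell's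
  CERTIFIED dodger/UC cells: cc-s2-6 `73 ≤ q ≤ 2999`, idea-2 PART XIX twin-prime cells `q ≤ 96221`).
No `sorry`, standard axioms; every ingredient is a theorem of this track or of Mathlib.

References: this track (ATTEMPT-16 THEOREMS 16.1–16.2, ATTEMPT-19 §7–§8, ATTEMPT-21 §1–§7).
-/

set_option linter.dupNamespace false

noncomputable section

open Real Complex Set MeasureTheory Literature.NumberTheory.LFunctions Literature.NumberTheory.LFunctions.WeilContinuous

namespace Summit.RiemannHypothesis.RiemannHypothesis.Theorems.Handoff

open Summit.RiemannHypothesis.RiemannHypothesis.Theorems.MotivicDoor.SemilocalThreshold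
open Summit.RiemannHypothesis.RiemannHypothesis.Theorems.HandoffDecomposition (nextPrime nextPrime_prime lt_nextPrime nextPrime_le consecutivePrimes_nextPrime)
open Summit.RiemannHypothesis.RiemannHypothesis.Theorems.SemilocalClassLaw

set_option maxHeartbeats 400000 in
/-- **THEOREM (the RH-free zero-sum family at rate `(1/5)(log q)^{3/2}q^{−3/2}` from `q₀ = 60000` on).**
[this track, ATTEMPT-16 THEOREM 16.2; ATTEMPT-21 §7] -/
theorem subwindowZeroSumFamily_sixtyThousand : SubwindowZeroSumFamily (1 / 5) 60000 := by
  intro q q' hqq' hq₀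
  obtain ⟨hqprime, -, hqq, -⟩ := hqq'
  have hq2 : 2 ≤ q := hqprime.two_le
  have hq0 : (0 : ℝ) < q := by exact_mod_cast hqprime.pos
  -- the mollifier radius `r = 1/(q³+1)`, a generic `ε ∈ [r, 2r]`, the half-width `b = L/2 − ε`
  have hr : (bump (q ^ 3)).rOut = 1 / ((q : ℝ) ^ 3 + 1) := by rw [bump_rOut]; push_cast; ring
  have hr0 : 0 < (bump (q ^ 3)).rOut := (bump (q ^ 3)).rOut_pos
  obtain ⟨ε, ⟨hε1, hε2⟩, hgen⟩ := exists_generic_shift (Real.log q) hr0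
  set b : ℝ := Real.log q / 2 - ε with hb
  have hbq1 : b + (bump (q ^ 3)).rOut ≤ Real.log q / 2 := by linarith
  have hbq2 : Real.log q / 2 ≤ b + 2 * (bump (q ^ 3)).rOut := by linarith
  -- part (3), first conjunct: `11/2 ≤ b`, `2b ≤ L ≤ 2b + 1/100`
  obtain ⟨-, -, -, -, -, hb55, hL1, hL2, -⟩ := radius_facts_small hq₀ rfl hr hbq1 hbq2
  have hb1 : 1 ≤ b := by linarith
  have hL0 : 0 < Real.log q := by linarith
  -- parts (1): the horizon
  obtain ⟨hside1, hside2⟩ := small_horizon_side_conditions hb55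
  obtain ⟨hA, hB, hT3, hk2, hℓ2, hK1, -⟩ := small_horizon_index_bounds hb55
  obtain ⟨h101, hT'T₀, hexp2b, -, hcI, hcI2, hcL, hpL, hpU0, hpU, hW1, hW2, hk2', hk04, hTe⟩ := small_horizon_sizes_B hb55
  have hTT₀ : π * (dodgerKprime b : ℝ) / b ≤ 2 * π * Real.exp (1 + 2 * b) := hT'T₀
  have hT₀T : 2 * π * Real.exp (1 + 2 * b) ≤ 101 / 100 * (π * (dodgerKprime b : ℝ) / b) := h101
  have hp : 0 < dodgerPL b := lt_of_lt_of_le (by have := Real.pi_pos; positivity) hpL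
  -- part (3): the window conditions
  obtain ⟨⟨-, -, hL2'⟩, ⟨hδU0, hδU1, hδb⟩, ⟨hr600, hr6⟩, hδC, hwin, ⟨hQ0, hQ⟩⟩ :=
    window_conditions_small (T := π * (dodgerKprime b : ℝ) / b) (pL := dodgerPL b) (pU := dodgerPU b)
      (y := 2 * (Real.log q * Real.sqrt (Real.log q))) hq₀ rfl hr hbq1 hbq2 hTe hTT₀ hT₀T hpL hpU0 hpU
      rfl rfl rfl
  -- part (2): the profile-control constants
  obtain ⟨hN, hρ11, hρ2e, hκ⟩ :=
    profile_constants_small (T := π * (dodgerKprime b : ℝ) / b) (k := (dodgerKprime b : ℝ)) (pL := dodgerPL b) (W := dodgerW b)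
      (y := 2 * (Real.log q * Real.sqrt (Real.log q))) (N₁ := ⌈13 / 2 * Real.log q⌉₊) hb55 hL1 hL2 hTe hW1 hW2 hk2'
      hk04 hpL rfl rfl rfl rfl rfl rfl rfl rfl rfl
  -- part (5): the profile value
  have hΦ := profile_value_small hb55 hL1 (rfl : 2 * (Real.log q * Real.sqrt (Real.log q)) = _)
    (summable_dodgerPhiTerm (9 * (2 * (Real.log q * Real.sqrt (Real.log q))) ^ 2 / 64)).hasSum
  -- part (4): the comparison
  have hlt := cost_lt_gain_small (cI := dodgerCI b) (r := (bump (q ^ 3)).rOut) hb55 hL1 hTe hTT₀ hk2' hk04 hcI hcI2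
    rfl rfl hδU0 hδU1 hQ0 hQ hκ hr600 rfl rfl hpU0 hpU (dodgerPhi_pos (by positivity)).le le_rfl hΦ
  -- the genericity of the lattice
  have hgen' : ∀ ρ : ℂ, riemannZeta ρ = 0 → 0 < ρ.im →
      ∀ k ∈ Finset.range (zetaZeroCount (π * (dodgerKprime b : ℝ) / b)), dodgerNode ρ - latticeFreq b (k + 1) ≠ 0 := by
    intro ρ hζ hρ k _
    have h := hgen ρ hζ hρ.ne' k
    rw [sub_ne_zero]
    simpa [dodgerNode, latticeFreq] using h
  -- the explicit dodger
  exact dodger_witness_explicit (q := q) (q' := q') (b := b) (T₀ := dodgerT₀ b)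
    (y := 2 * (Real.log q * Real.sqrt (Real.log q))) (C := 1 / 5) (n := q ^ 3) (k' := dodgerKprime b)
    (N₁ := ⌈13 / 2 * Real.log q⌉₊) hb1 rfl hside1 hside2 hA hB hT3 hk2 hℓ2 hK1 rfl rfl rfl rfl rfl rfl (by positivity)
    rfl rfl rfl rfl rfl rfl rfl rfl rfl hcL hp hN hρ11 hρ2e (le_trans (by norm_num) hκ) hδb hr6 hδC (hwin q' (by omega)) hbq1 hbq2
    hgen' hlt

/-- **COROLLARY (the Dodger wall ceiling from `60000`, RH-free).** `∀ primes q ≥ 60000, δ*(q) ≤ (1/5)(log q)^{3/2} q^{−3/2}`.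
[this track, ATTEMPT-21 §7] -/
theorem dodgerWallCeiling_sixtyThousand : DodgerWallCeiling (1 / 5) 60000 :=
  dodgerWallCeiling_of_zeroSumFamily subwindowZeroSumFamily_sixtyThousand

/-- **COROLLARY (the RH-free UPPER CLAUSE from an explicit small prime).** For every prime `q ≥ 60000`: `a*(S_{<q}) < (log q⁺)/2`,
`q⁺` the next prime (from the witness family's own window clause; no hypothesis on the prime gap). [this track, ATTEMPT-21 §7] -/
theorem upperClause_from_sixtyThousand {q : ℕ} (hq : q.Prime) (hq₀ : 60000 ≤ q) :
    weilSemilocalThreshold (Nat.primesBelow q) < Real.log (nextPrime q) / 2 := by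
  have hqq' := consecutivePrimes_nextPrime hq
  obtain ⟨θ, δ, hθ, hθs, hδ, -, hwin, hneg⟩ :=
    subwindowWitnessFamily_of_zeroSumFamily subwindowZeroSumFamily_sixtyThousand q (nextPrime q) hqq' hq₀
  have h := wallOffset_lt_of_translatePair hqq' hθ hθs hδ hwin hneg
  simp only [HandoffMarginLaw.wallOffset] at h
  linarith

/-- C-I(a) at every prime `q ≥ 60000`, in the `∀ q' > q` currency of the WEIL route's leaf. [this track, ATTEMPT-21 §7] -/
theorem classLaw_from_sixtyThousand {q : ℕ} (hq : q.Prime) (hq₀ : 60000 ≤ q) :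
    ∀ q' : ℕ, q'.Prime → q < q' → weilSemilocalThreshold (Nat.primesBelow q) < Real.log q' / 2 :=
  forall_prime_gt_lt_iff_upperClause.2 (upperClause_from_sixtyThousand hq hq₀)

/-- **THE WEIL ROUTE'S CRUX REDUCED TO THE CERTIFIED RANGE (RH-free bookkeeping).** `SemilocalClassLawTail` (C-I(a) for all primes
`q ≥ 80`) holds iff the upper clause holds at the primes `80 ≤ q < 60000`. [this track, ATTEMPT-21 §7] -/
theorem semilocalClassLawTail_iff_range_sixtyThousand :
    SemilocalClassLawTail ↔
      ∀ q : ℕ, q.Prime → 80 ≤ q → q < 60000 →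
        weilSemilocalThreshold (Nat.primesBelow q) < Real.log (nextPrime q) / 2 := by
  rw [semilocalClassLawTail_iff_forall_upperClause]
  refine ⟨fun h q hq h80 _ ↦ h q hq h80, fun h q hq h80 ↦ ?_⟩
  rcases Nat.lt_or_ge q 60000 with hlt | hge
  · exact h q hq h80 hlt
  · exact upperClause_from_sixtyThousand hq hge

/-- The whole leaf likewise: `SemilocalClassLawAll` iff the upper clause at every prime `q < 60000`. [this track, ATTEMPT-21 §7] -/
theorem semilocalClassLawAll_iff_upperClause_range_sixtyThousand :
    SemilocalClassLawAll ↔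
      ∀ q : ℕ, q.Prime → q < 60000 → weilSemilocalThreshold (Nat.primesBelow q) < Real.log (nextPrime q) / 2 := by
  rw [semilocalClassLawAll_iff_forall_upperClause]
  refine ⟨fun h q hq _ ↦ h q hq, fun h q hq ↦ ?_⟩
  rcases Nat.lt_or_ge q 60000 with hlt | hge
  · exact h q hq hlt
  · exact upperClause_from_sixtyThousand hq hge

end Summit.RiemannHypothesis.RiemannHypothesis.Theorems.Handoff

end
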